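import Summits.BirchSwinnertonDyer.BirchSwinnertonDyer.Theorems.AdditiveKolyvaginRoadManinFrameOffExceptionClass
import Literature.NumberTheory.EllipticCurves.IsogenyPotentiallyGoodMinimalDiscriminant
import HarnessLib

/-!
# Route `AdditiveKolyvaginRoad`, support item `ManinFrameOffExceptionClass`
# (stmt-BirchSwinnertonDyer-20092): the item READ ON THE CURVE — the class hypothesis discharged from
# `¬ TypeGOrd W p ∨ 4 < ord_p Δ_min(W)` granted Dokchitser–Dokchitser 2015 Thm. 5.1 (1)

Cell `pub/bsd-wall` (D-0120, W-ALL lane 3, row 2), seat `bsd-wall-akr-p2` (prover); `--supports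
stmt-BirchSwinnertonDyer-20092`. THEOREMS ONLY (no definition, no `sorry`); nothing is booked.

`AdditiveKolyvaginRoadManinFrameOffExceptionClass.lean` proves the item with its CLASS-quantified
hypothesis (every globally minimal `W' ∼ W` off Edixhoven's exception) and the two rows that are
readable on `W` alone inside the tree (`¬ TypeGOrd W p`; `ord_p Δ_min(W) = 6`). The remaining bit
`4 < ord_p Δ_min(W)` moves inside the tree at most by `v ↦ 12 − v` along a (G)-class
(`padicValInt_minimalDiscriminantInt_eq_or_add_eq_twelve_of_isIsogenous_of_typeG`). With `E[p]`
irreducible a cyclic `ℚ`-isogeny `W → W'` has degree prime to `p`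
(`X11b.not_dvd_degree_of_isCyclic_of_irr`), and the Literature named fact
`dokchitser_padicValInt_minimalDiscriminantInt_eq_of_isogeny_of_not_dvd_degree` (Dokchitser–Dokchitser
2015 Thm. 5.1 (1), clause `l ≠ p`: a prime-to-`p` isogeny preserves `ord_p Δ_min` at a potentially
good `p`) pins `v`. Hence, GRANTED that fact (hypothesis `hDD`, displayed; CONDITIONAL on it):
`strongException_of_four_lt`, `strongException_of_exception` (the curve-level disjunction transports
to the class) and `frame_of_exception_of_dokchitser` — the statement of the retired gen-1 item
`ManinFrameOffEdixhovenException` (stmt-BirchSwinnertonDyer-20280: the frame for every AKR pair with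
`p ≥ 11`, `Addv`, `Irr`, `r_an = 1`, `¬ TypeGOrd W p ∨ 4 < ord_p Δ_min(W)`), now as a corollary of the
class item.

References: [DokchitserDokchitser2015LocalInvariants] Thm. 5.1 (1), Table 1; [EdixhovenManin1991]
Thm. 3; [SilvermanAEC2009] III.4.11, VII.5.5.
-/

set_option autoImplicit false
-- the Theorems directory repeats the summit name (sibling precedent `SignedBaseChangeAssembly.lean`)
set_option linter.dupNamespace false

noncomputable section

open scoped Classical

open WeierstrassCurve NumberField Literature.NumberTheory.EllipticCurves
  Literature.NumberTheory.EllipticCurves.ModularForms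
  Literature.NumberTheory.EllipticCurves.Rank1Residual
  Summit.BirchSwinnertonDyer.Rank1Residual Summit.BirchSwinnertonDyer.Rank1Residual.Additive

namespace Summit.BirchSwinnertonDyer.BirchSwinnertonDyer.Theorems.ManinFrameOffExceptionClass

section Transport

variable {W W₀ : WeierstrassCurve ℚ} [W.IsElliptic] [W.IsGloballyMinimal] [W₀.IsElliptic]
  [W₀.IsGloballyMinimal] {p : ℕ} [hp : Fact p.Prime]

/-- **`4 < ord_p Δ_min(W)` transports to every member, GRANTED Dokchitser–Dokchitser** (`hDD`):
with `E[p]` irreducible a cyclic `ℚ`-isogeny `W → W₀` has degree prime to `p`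
(`X11b.not_dvd_degree_of_isCyclic_of_irr`), (G)-ord gives `0 ≤ ord_p j` (potentially good,
`padicValRat_j_nonneg_of_typeGOrd`), so `ord_p Δ_min(W₀) = ord_p Δ_min(W)`; off (G)-ord the first
disjunct transports (`strongException_of_not_typeGOrd`).
[cite: DokchitserDokchitser2015LocalInvariants, Thm. 5.1 (1) and Table 1]
[cite: SilvermanAEC2009, Cor. III.4.11 and Prop. III.4.12] -/
theorem strongException_of_four_lt
    (hDD : dokchitser_padicValInt_minimalDiscriminantInt_eq_of_isogeny_of_not_dvd_degree)
    (hp5 : 5 ≤ p) (hadd : Addv W p) (hirr : Irr W p) (hiso : IsIsogenous W W₀)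
    (hv : 4 < padicValInt p W.minimalDiscriminantInt) :
    ¬ TypeGOrd W₀ p ∨ 4 < padicValInt p W₀.minimalDiscriminantInt := by
  by_cases hG : TypeGOrd W p
  · right
    obtain ⟨ψ, hψ⟩ := hiso.exists_isCyclic
    have hdeg : ¬ p ∣ ψ.degree := X11b.not_dvd_degree_of_isCyclic_of_irr ψ hψ hp.out hirr
    have hj : 0 ≤ padicValRat p W.j := padicValRat_j_nonneg_of_typeGOrd W p hG
    rw [← hDD W W₀ ψ p hp.out hdeg hj]
    exact hv
  · exact strongException_of_not_typeGOrd (by omega) hadd hiso hG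

/-- The curve-level disjunction `¬ TypeGOrd W p ∨ 4 < ord_p Δ_min(W)` transports to every member of
the class, GRANTED Dokchitser–Dokchitser. [cite: DokchitserDokchitser2015LocalInvariants, Thm. 5.1 (1) and Table 1] -/
theorem strongException_of_exception
    (hDD : dokchitser_padicValInt_minimalDiscriminantInt_eq_of_isogeny_of_not_dvd_degree)
    (hp5 : 5 ≤ p) (hadd : Addv W p) (hirr : Irr W p) (hiso : IsIsogenous W W₀)
    (hexc : ¬ TypeGOrd W p ∨ 4 < padicValInt p W.minimalDiscriminantInt) :
    ¬ TypeGOrd W₀ p ∨ 4 < padicValInt p W₀.minimalDiscriminantInt :=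
  hexc.elim (strongException_of_not_typeGOrd (by omega) hadd hiso)
    (strongException_of_four_lt hDD hp5 hadd hirr hiso)

end Transport

open Summit.BirchSwinnertonDyer.BirchSwinnertonDyer.Theses.AdditiveKolyvaginRoad in
/-- **The item read on the curve, GRANTED Dokchitser–Dokchitser 2015 Thm. 5.1 (1)** (the statement
of the retired gen-1 item `ManinFrameOffEdixhovenException`, stmt-BirchSwinnertonDyer-20280): for
every AKR pair `(W, p)` with `p ≥ 11`, additive at `p`, `E[p]` irreducible, `r_an = 1` and
`¬ TypeGOrd W p ∨ 4 < ord_p Δ_min(W)` ON `W`, the Manin-good odd Heegner frame exists — the class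
hypothesis of `maninFrameOffExceptionClass_proof` is supplied by `strongException_of_exception`.
CONDITIONAL on the displayed named fact `hDD`; unconditional in every other input.
[cite: DokchitserDokchitser2015LocalInvariants, Thm. 5.1 (1) and Table 1] [cite: EdixhovenManin1991, Thm. 3]
[cite: HoffsteinLuo1997, Theorem (§1)] [cite: Darmon2004, Thm. 3.6] -/
theorem frame_of_exception_of_dokchitser
    (hDD : dokchitser_padicValInt_minimalDiscriminantInt_eq_of_isogeny_of_not_dvd_degree)
    (hEdx : EdixhovenManinNonPotOrdinary) (hEdxK : EdixhovenManinKodairaType)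
    (hPub : PublishedInputsAdditiveKoly)
    (W : WeierstrassCurve ℚ) [W.IsElliptic] [W.IsGloballyMinimal] (p : ℕ) [Fact p.Prime]
    [NeZero (W.conductorNorm ℤ)] (hp11 : 11 ≤ p) (hadd : Addv W p) (hirr : Irr W p)
    (hexc : ¬ TypeGOrd W p ∨ 4 < padicValInt p W.minimalDiscriminantInt) (hr : W.analyticRank = 1) :
    ∃ (K : Type) (_ : Field K) (_ : NumberField K)
      (Dt : ModularParametrizationData W (W.conductorNorm ℤ))
      (H : HeegnerDatum (W.conductorNorm ℤ) (NumberField.discr K)) (ι : K →+* ℂ)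
      (P : (W.baseChange K).toAffine.Point)
      (Wd : WeierstrassCurve ℚ) (_ : Wd.IsElliptic) (_ : Wd.IsGloballyMinimal) (Cd : VariableChange ℚ),
      IsImaginaryQuadratic K ∧ Odd (NumberField.discr K) ∧ ¬ (p : ℤ) ∣ NumberField.discr K ∧
        SatisfiesHeegnerHypothesis (W.conductorNorm ℤ) K ∧
        WeierstrassCurve.Affine.Point.map ι.toRatAlgHom P = heegnerPointComplex Dt H ∧
        ¬ (p : ℤ) ∣ Dt.c ∧ ¬ p ∣ Units.torsionOrder K ∧
        (W.quadraticTwist (NumberField.discr K : ℚ)).entireLFunction 1 ≠ 0 ∧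
        Cd • W.quadraticTwist (NumberField.discr K : ℚ) = Wd :=
  maninFrameOffExceptionClass_proof hEdx hEdxK hPub W p hp11 hadd hirr
    (fun _ _ _ hiso ↦ strongException_of_exception hDD (by omega) hadd hirr hiso hexc) hr

end Summit.BirchSwinnertonDyer.BirchSwinnertonDyer.Theorems.ManinFrameOffExceptionClass

end
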